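import Summits.BirchSwinnertonDyer.BirchSwinnertonDyer.Theorems.SignedBaseChangeAnticyclotomicEisensteinDivisibilityAdmdefLayerZeroDictionary
import Summits.BirchSwinnertonDyer.BirchSwinnertonDyer.Theorems.SignedBaseChangeAnticyclotomicEisensteinDivisibilityAdmdefUnramifiedIsotropy
import Summits.BirchSwinnertonDyer.BirchSwinnertonDyer.Theorems.SignedBaseChangeAnticyclotomicEisensteinDivisibilityAdmdefSelmerBookkeeping
import Summits.BirchSwinnertonDyer.BirchSwinnertonDyer.Theorems.AdditiveKolyvaginRoadIso
import Literature.NumberTheory.EllipticCurves.HeegnerPointsKolyvaginClassesPointsProofs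
import HarnessLib

/-!
# Line `admdef` (crux `AnticyclotomicEisensteinDivisibility`, stmt-BirchSwinnertonDyer-20727), rigidity road: HOWARD'S VANISHING LEMMA at the
# bottom layer — a unit `λ_1(n)(0)` KILLS the `n`-ordinary signed Selmer group `Sel^ε_n(K_0, E[p])` — modulo the `±` CONTROL at `p` and the
# ramification of `E[p]` at the bad places (hypotheses)

LEAD seat bsd-line-sbc-p1 (gen 28), `--supports stmt-BirchSwinnertonDyer-20727` (helper; OFF the v23 composition path; the hypothesis (HV) of
`…AdmdefHowardMerge` — [Howard2006] Lem. 2.3.4 ∕ [BertoliniDarmon2005] proof of Thm. 4.1 ∕ W. Zhang Prop. 5.4's see-saw — for CHKLL25's signed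
bipartite systems, from the tree's Tate reciprocity law for the totally complex `K`).  THE THEOREM (`eq_zero_of_mem_signedOrdSelmerTorsion_of_isUnit_lam`):
for a signed bipartite system `B` of sign `ε` at level `N = N_E` (`IsSignedBipartiteSystem`) on the cell-β frame (`p ≥ 5`, `ρ̄_{E,p}` onto, `K`
imaginary quadratic, `N_E` Heegner, `p` split, `κ` anticyclotomic), GIVEN
  (CTRL) at the places `v ∣ p` the layer-0 signed condition implies the KUMMER condition: `T X ∈ condAboveTorsion v (sgn ε) 0 1 ⟹ X ∈
         selmerLocalKer (K_v)` [HYPOTHESIS — one half of the `±` control theorem `ℋ^±_{0,v}[p] = E(K_v)/p`, B.-D. Kim 2007 Prop. 4.18 ∕ Kobayashi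
         2003 Thm. 6.2 ∕ B.-D. Kim 2013 §3; NOT in the tree];
  (RAM)  `E[p]` is RAMIFIED at every bad place `v ∤ p` of `E/K` [HYPOTHESIS — CHKLL25 Thm. 7.1 (ii) «`E[p]` ramified at every `q ∣ N`» in the
         base-changed currency];
then for every `n ∈ 𝒩_1^def` with `λ_1(n)(0) ∈ ℤ_pˣ`: **`Sel^ε_n(K_0, E[p]) = signedOrdSelmerTorsion (E/K) p κ ε n 0 1 = 0`**.

PROOF.  Let `c ∈ Sel_n`, `c ≠ 0`; lift to `X ∈ H¹(K, E[p])` (`T` is onto, `…AdmdefLayerZeroDictionary`).  Čebotarev with the sign (`…AdmdefRootZero.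
exists_admissible_torsionLocMap_ne_zero`, outside the primes of `n`) gives a `1`-admissible `q ∤ n`, `v = (q)`, with `loc_v X ≠ 0`; `nq ∈ 𝒩_1^ind`.
The FIRST reciprocity law with its witness-free ordinary line (`…AdmdefOrdLineNonzero.isUnit_lam_iff_ordLoc_kappa_ne_zero_adicCompletionPrime`, LEAD g27)
makes `d = κ_1(nq)_0 ∈ Sel_{nq}` RAMIFIED at the chosen prime `𝔓₀ ∣ v`; lift `d` to `D`.  Both `X` and `D` lie in the subgroup `A ≤ H¹(K, E[p])` of
classes whose bottom-layer restriction is signed at `p`, ordinary at the primes of `n`, unramified elsewhere EXCEPT at `v`; for two classes of `A`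
the local Weil cup products vanish at every place `w ≠ v`: at `∞` and at good places off `n·q` by the KUMMER isotropy (tree; (CTRL) at `w ∣ p`,
Gross (7.1) at good `w ∤ p`), at the primes of `n` by the TORIC isotropy (`…LayerZeroDictionary.mem_toricLocalKer_of_forall_mem_ordinaryAt` + AKR),
at the bad places by the UNRAMIFIED isotropy (`…AdmdefUnramifiedIsotropy`, (RAM)).  So by the tree's Poitou–Tate see-saw for the totally complex
`K` (`Method2.Iso.exists_zsmul_localization_of_forall_ne`: the image of `A` at `v` is a line) `loc_v D = a • loc_v X`; then `loc_v (D − aX) = 0`, so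
the ordinary coordinate of `d − a c` at `𝔓₀` vanishes (`…LayerZeroDictionary`), and `c ∈ Sel_n` is unramified at `𝔓₀ ∣ q ∤ n` — whence the
ordinary coordinate of `d` vanishes: contradiction.

HONEST FRAMING: theorems only (no definition, no named fact, no `sorry`); (CTRL) and (RAM) are HYPOTHESES; nothing about the crux, the anchors
(K1) or BSD is asserted.  With `…AdmdefHowardMerge`: `B.HasUnitLambda N` + (CTRL) + (RAM) + «`Sel^ε_1(K_0, E[p])` is a line» ⟹ `z_{0,1} ≠ 0`
(`…AdmdefHowardMerge.limitBaseClass_layer_zero_one_ne_zero_of_hasUnitLambda_of_vanishing` ∘ this file) — Howard's Thm. 3.2.3 (c) at the root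
mod `𝔪` for the pinned system, in kernel modulo the `±` control at `p`.

References: [cite: Howard2006, Lem. 2.2.1, Lem. 2.3.4, Thm. 3.2.3] [cite: BertoliniDarmon2005, Thm. 3.2, Lemma 2.6, proof of Thm. 4.1]
[cite: WZhang2014, Prop. 5.4, Lemma 7.3, §9 (9.1)–(9.3)] [cite: CastellaEtAl2025, Thm. 7.1 (ii), Thm. 7.4, §7.2 (arXiv:2308.10474v2 pp. 29–30)]
[cite: MilneADT2006, Ch. I, Thm. 4.10] [cite: BDKim2013, Def. 3.5, §3] [cite: GrossLMS1991, §7 (7.1), Prop. 6.2 (1)].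
-/

-- D-0017: single-problem summit, the namespace repeats the problem name by design.
set_option linter.dupNamespace false
set_option autoImplicit false

noncomputable section

open scoped Classical NumberField Pointwise

namespace Summit.BirchSwinnertonDyer.BirchSwinnertonDyer.Theorems.SignedBaseChangeAcDivAdmdefHowardVanishing

open CategoryTheory WeierstrassCurve NumberField IsDedekindDomain Field
open Literature.NumberTheory.EllipticCurves Literature.NumberTheory.GaloisRepresentations
open Literature.NumberTheory.EllipticCurves.CastellaHsuKunduLeeLiu2025
open Literature.NumberTheory.EllipticCurves.BertoliniDarmon2005
open Literature.NumberTheory.EllipticCurves.AcSigned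
open Summit.BirchSwinnertonDyer.BirchSwinnertonDyer.Theorems.AdditiveKoly
open Summit.BirchSwinnertonDyer.Rank1Residual.X11b.Three.Koly.Method2
open Summit.BirchSwinnertonDyer.BirchSwinnertonDyer.Theorems.SignedBaseChangeAcDivAdmdefCoreRootOfSeenAnchor
open Summit.BirchSwinnertonDyer.BirchSwinnertonDyer.Theorems.SignedBaseChangeAcDivAdmdefRootZero
open Summit.BirchSwinnertonDyer.BirchSwinnertonDyer.Theorems.SignedBaseChangeAcDivAdmdefBipartitePropagation
open Summit.BirchSwinnertonDyer.BirchSwinnertonDyer.Theorems.SignedBaseChangeAcDivAdmdefOrdLineNonzero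
open Summit.BirchSwinnertonDyer.BirchSwinnertonDyer.Theorems.SignedBaseChangeAcDivAdmdefSelmerBookkeeping
open Summit.BirchSwinnertonDyer.BirchSwinnertonDyer.Theorems.SignedBaseChangeAcDivAdmdefLayerZeroDictionary
open Summit.BirchSwinnertonDyer.BirchSwinnertonDyer.Theorems.SignedBaseChangeAcDivAdmdefUnramifiedIsotropy
open scoped ContRepresentation

universe u

variable {K : Type} [Field K] [NumberField K] {W : WeierstrassCurve ℚ} [W.IsElliptic] [W.IsGloballyMinimal] {p : ℕ} [Fact p.Prime]
  {κ : ZpExtension K p} {γ : absoluteGaloisGroup K} {N : ℕ} {ε : ℤˣ} {B : SignedBipartiteSystem W K p κ}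

omit [NumberField K] [W.IsElliptic] [W.IsGloballyMinimal] [Fact p.Prime] in
/-- `n · q ∈ 𝒩_1^ind` for `n ∈ 𝒩_1^def` and a `1`-admissible prime `q ∤ n` (square-free, admissible prime factors, one more of them).
[cite: Howard2006, Def. 3.2.1] [cite: CastellaEtAl2025, §7.2 (arXiv:2308.10474v2 p0030 L1–L6)] -/
theorem mul_mem_indefProducts_of_mem_defProducts {a : ℕ → ℤ} {n q : ℕ} (hn : n ∈ defProducts N K a p 1)
    (hq : IsAdmissiblePrime N K a p 1 q) (hqn : ¬ q ∣ n) : n * q ∈ indefProducts N K a p 1 := by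
  have hqp : q.Prime := hq.prime
  have hcop : Nat.Coprime n q := Nat.coprime_comm.mp ((Nat.Prime.coprime_iff_not_dvd hqp).mpr hqn)
  refine ⟨⟨Nat.squarefree_mul_iff.mpr ⟨hcop, hn.1.1, hqp.squarefree⟩, fun ℓ hℓ hℓnq ↦ ?_⟩, ?_⟩
  · rcases (Nat.Prime.dvd_mul hℓ).mp hℓnq with h | h
    · exact hn.1.2 ℓ hℓ h
    · rwa [(Nat.prime_dvd_prime_iff_eq hℓ hqp).mp h]
  · rw [Nat.Coprime.primeFactors_mul hcop, hqp.primeFactors,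
      Finset.card_union_of_disjoint (by rw [← hqp.primeFactors]; exact Nat.Coprime.disjoint_primeFactors hcop),
      Finset.card_singleton, Nat.even_add_one]
    exact Nat.not_even_iff_odd.mpr hn.2

/-- **Howard's vanishing lemma at the bottom layer, modulo the `±` control at `p` and the ramification of `E[p]` at the bad places.**  See the
module docstring for the frame, the two hypotheses (CTRL) and (RAM), and the proof (Čebotarev; the first reciprocity law with its witness-free
ordinary line; Tate reciprocity for the totally complex `K` with the Kummer / toric / unramified isotropies at the places `w ≠ v`; the ordinary
coordinate at `𝔓₀`).  CONCLUSION: `λ_1(n)(0) ∈ ℤ_pˣ`, `n ∈ 𝒩_1^def` ⟹ every class of `Sel^ε_n(K_0, E[p])` is zero.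
[cite: Howard2006, Lem. 2.3.4, Thm. 3.2.3] [cite: BertoliniDarmon2005, proof of Thm. 4.1, Lemma 2.6] [cite: WZhang2014, Prop. 5.4]
[cite: MilneADT2006, Ch. I, Thm. 4.10] [cite: CastellaEtAl2025, Thm. 7.4 first law, Thm. 7.1 (ii)] -/
theorem eq_zero_of_mem_signedOrdSelmerTorsion_of_isUnit_lam (hB : IsSignedBipartiteSystem W K p κ γ N ε B)
    (hN : (N : ℤ) = W.conductorNorm ℤ) (h5 : 5 ≤ p) (hsurj : W.HasSurjectiveModNGaloisRep p) (hK : IsImaginaryQuadratic K)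
    (hH : SatisfiesHeegnerHypothesis (W.conductorNorm ℤ) K) (hsp : ((Ideal.span {(p : ℤ)}).primesOver (𝓞 K)).ncard = 2)
    (hκ : κ.IsAnticyclotomic)
    (hctrl : ∀ v : HeightOneSpectrum (𝓞 K), ((p : ℕ) : 𝓞 K) ∈ v.asIdeal → ∀ X : Vp W K p,
      resH1Hom (Literature.NumberTheory.EllipticCurves.subgroupIncl (κ.layerSubgroup 0))
          (AddSubgroup.inclusion (geomTorsion_natCast_pow_one W (K := K) (p := p)).le) (fun _ _ ↦ rfl) X ∈
        condAboveTorsion (W.baseChange K) p κ v (.sgn ε) 0 1 →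
      X ∈ selmerLocalKer (W.baseChange K) (v.adicCompletion K) ((p ^ 1 : ℕ) : ℤ))
    (hram : ∀ v : HeightOneSpectrum (𝓞 K), ¬ (W.baseChange K).HasGoodReductionAt v → ((p : ℕ) : 𝓞 K) ∉ v.asIdeal →
      ∃ 𝔓 ∈ v.primesAbove, ∃ τ ∈ 𝔓.inertia (absoluteGaloisGroup K), ∃ P : geomTorsion (W.baseChange K) ((p ^ 1 : ℕ) : ℤ), τ • P ≠ P)
    {n : ℕ} (hn : n ∈ defProducts N K (fun ℓ ↦ W.frobeniusTrace ℓ) p 1) (hlam : IsUnit (PowerSeries.constantCoeff (B.lam 1 n))) :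
    ∀ c ∈ signedOrdSelmerTorsion (W.baseChange K) p κ ε n 0 1, c = 0 := by
  intro c hc
  by_contra hc0
  have hp : p.Prime := Fact.out
  have hN' : N = W.conductorNorm ℤ := by exact_mod_cast hN
  -- scaffolding for the local–global duality (as in AKR `hiso_of_admQ`)
  haveI : IsTotallyComplex K := hK.2
  haveI : Fact (Nat.Prime (p ^ 1)) := ⟨by rw [pow_one]; exact hp⟩
  haveI : PerfectField K := PerfectField.ofCharZero
  haveI hcs : ∀ (L : Type) [Field L], CompactSpace (absoluteGaloisGroup L) :=
    fun L _ ↦ @absoluteGaloisGroup_compactSpace L _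
  haveI : Finite (geomTorsion (W.baseChange K) ((p ^ 1 : ℕ) : ℤ)) := finite_geomTorsion_of_neZero (W.baseChange K) (p ^ 1)
  have hpZ : ((p ^ 1 : ℕ) : ℤ) ≠ 0 := by exact_mod_cast pow_ne_zero 1 hp.ne_zero
  obtain ⟨e, hμ, hadd₁, hadd₂, halt, hnondeg, hgal⟩ :=
    exists_weilPairing_holds (W.baseChange K) (p ^ 1) (by rw [pow_one]; exact hp.two_le) (by
      rw [pow_one]; exact_mod_cast hp.ne_zero)
  -- (1) lift `c` to `X ∈ H¹(K, E[p])`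
  obtain ⟨X, hX⟩ := exists_resH1Hom_layerZero_eq W κ c
  have hX0 : X ≠ 0 := by
    rintro rfl
    exact hc0 (by rw [← hX, map_zero])
  -- (2) Čebotarev outside the primes of `n`: a `1`-admissible `q ∤ n` with `loc_v X ≠ 0`
  obtain ⟨q, hqB, hadmE, v, hqv, hloc⟩ :=
    exists_admissible_torsionLocMap_ne_zero W K p h5 hsurj hK hH hsp X hX0 n.primeFactors
  have hadm : IsAdmissiblePrime N K (fun ℓ ↦ W.frobeniusTrace ℓ) p 1 q := by rw [hN']; exact hadmE
  have hq : q.Prime := hadmE.1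
  have hqn : ¬ q ∣ n := fun h ↦ hqB (Nat.mem_primeFactors.mpr ⟨hq, h, hn.1.1.ne_zero⟩)
  have huniq : ∀ w : HeightOneSpectrum (𝓞 K), ((q : ℕ) : 𝓞 K) ∈ w.asIdeal → w = v :=
    fun w hw ↦ placesAbove_eq_of_isPrime_span K hadmE.2.2.1 hq.ne_zero hqv hw
  obtain ⟨hgoodv, hpv⟩ := hasGoodReductionAt_of_isAdmissiblePrime W K hadmE v hqv
  have hpv' : ((p : ℕ) : 𝓞 K) ∉ v.asIdeal := by rw [← Int.cast_natCast]; exact hpv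
  have hpv1 : ((p ^ 1 : ℕ) : 𝓞 K) ∉ v.asIdeal := by rw [Nat.pow_one]; exact hpv'
  have hnov : ¬ ∃ ℓ : ℕ, ℓ.Prime ∧ ℓ ∣ n ∧ ((ℓ : ℕ) : 𝓞 K) ∈ v.asIdeal := by
    rintro ⟨ℓ, hℓ, hℓn, hℓv⟩
    have hne : q ≠ ℓ := fun h ↦ hqn (h ▸ hℓn)
    have h := not_mem_asIdeal_of_coprime K ((Nat.coprime_primes hq hℓ).mpr hne) v hqv
    exact h (by exact_mod_cast hℓv)
  -- (3) `nq ∈ 𝒩_1^ind` and the RAMIFIED class `d = κ_1(nq)_0 ∈ Sel_{nq}` (first law, witness-free)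
  have hnq : n * q ∈ indefProducts N K (fun ℓ ↦ W.frobeniusTrace ℓ) p 1 := mul_mem_indefProducts_of_mem_defProducts hn hadm hqn
  have hd_ord : resOfLe (geomTorsion (W.baseChange K) ((p : ℤ) ^ 1))
      (inf_le_right.trans (κ.kerSubgroup_le_layerSubgroup 0) :
        (adicCompletionPrime K v).inertia (absoluteGaloisGroup K) ⊓ κ.kerSubgroup ≤ κ.layerSubgroup 0)
      (B.kappa 1 (n * q) 0) ≠ 0 := by
    have h := (isUnit_lam_iff_ordLoc_kappa_ne_zero_adicCompletionPrime hB hN hK hκ hnq hadm hqn hqv).mp hlam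
    rwa [ordLoc_apply_zero] at h
  have hdSel : B.kappa 1 (n * q) 0 ∈ signedOrdSelmerTorsion (W.baseChange K) p κ ε (n * q) 0 1 :=
    kappa_layer_mem_signedOrdSelmerTorsion hB one_pos hnq 0
  obtain ⟨D, hD⟩ := exists_resH1Hom_layerZero_eq W κ (B.kappa 1 (n * q) 0)
  -- (4) the subgroup `A`: classes whose bottom-layer restriction is signed at `p`, ordinary on `n`, unramified off `n·p` EXCEPT at `v`
  set S : AddSubgroup ((W.baseChange K).torsionH1Over ((p : ℤ) ^ 1) (κ.layerSubgroup 0)) :=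
    (⨅ (w : HeightOneSpectrum (𝓞 K)) (_ : ((p : ℕ) : 𝓞 K) ∈ w.asIdeal),
        condAboveTorsion (W.baseChange K) p κ w (.sgn ε) 0 1) ⊓
      (⨅ (w : HeightOneSpectrum (𝓞 K)) (_ : ((p : ℕ) : 𝓞 K) ∉ w.asIdeal)
        (_ : ∃ ℓ : ℕ, ℓ.Prime ∧ ℓ ∣ n ∧ ((ℓ : ℕ) : 𝓞 K) ∈ w.asIdeal)
        (𝔓 : Ideal (absIntegers (𝓞 K) K)) (_ : 𝔓 ∈ w.primesAbove),
        ordinaryAt (W.baseChange K) ((p : ℤ) ^ 1) (κ.layerSubgroup 0) 𝔓) ⊓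
      ⨅ (w : HeightOneSpectrum (𝓞 K)) (_ : ((p : ℕ) : 𝓞 K) ∉ w.asIdeal)
        (_ : ¬ ∃ ℓ : ℕ, ℓ.Prime ∧ ℓ ∣ n ∧ ((ℓ : ℕ) : 𝓞 K) ∈ w.asIdeal) (_ : w ≠ v)
        (𝔓 : Ideal (absIntegers (𝓞 K) K)) (_ : 𝔓 ∈ w.primesAbove),
        unramifiedAt (W.baseChange K) ((p : ℤ) ^ 1) (κ.layerSubgroup 0) 𝔓 with hSdef
  have hmemS : ∀ y, y ∈ S ↔
      (∀ w : HeightOneSpectrum (𝓞 K), ((p : ℕ) : 𝓞 K) ∈ w.asIdeal → y ∈ condAboveTorsion (W.baseChange K) p κ w (.sgn ε) 0 1) ∧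
      (∀ w : HeightOneSpectrum (𝓞 K), ((p : ℕ) : 𝓞 K) ∉ w.asIdeal →
        (∃ ℓ : ℕ, ℓ.Prime ∧ ℓ ∣ n ∧ ((ℓ : ℕ) : 𝓞 K) ∈ w.asIdeal) →
        ∀ 𝔓 ∈ w.primesAbove, y ∈ ordinaryAt (W.baseChange K) ((p : ℤ) ^ 1) (κ.layerSubgroup 0) 𝔓) ∧
      (∀ w : HeightOneSpectrum (𝓞 K), ((p : ℕ) : 𝓞 K) ∉ w.asIdeal →
        (¬ ∃ ℓ : ℕ, ℓ.Prime ∧ ℓ ∣ n ∧ ((ℓ : ℕ) : 𝓞 K) ∈ w.asIdeal) → w ≠ v →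
        ∀ 𝔓 ∈ w.primesAbove, y ∈ unramifiedAt (W.baseChange K) ((p : ℤ) ^ 1) (κ.layerSubgroup 0) 𝔓) := fun y ↦ by
    simp only [hSdef, AddSubgroup.mem_inf, AddSubgroup.mem_iInf, and_assoc]
  have hcS : c ∈ S := by
    obtain ⟨hA, hB', hC⟩ := (mem_signedOrdSelmerTorsion_iff c).mp hc
    exact (hmemS c).mpr ⟨hA, hB', fun w hpw hno _ 𝔓 h𝔓 ↦ hC w hpw hno 𝔓 h𝔓⟩
  have hdS : B.kappa 1 (n * q) 0 ∈ S := by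
    obtain ⟨hA, hB', hC⟩ := (mem_signedOrdSelmerTorsion_iff _).mp hdSel
    refine (hmemS _).mpr ⟨hA, fun w hpw hex 𝔓 h𝔓 ↦ ?_, fun w hpw hno hwv 𝔓 h𝔓 ↦ hC w hpw ?_ 𝔓 h𝔓⟩
    · obtain ⟨ℓ, hℓ, hℓn, hℓw⟩ := hex
      exact hB' w hpw ⟨ℓ, hℓ, hℓn.trans (dvd_mul_right n q), hℓw⟩ 𝔓 h𝔓
    · rintro ⟨ℓ, hℓ, hℓnq, hℓw⟩
      rcases (Nat.Prime.dvd_mul hℓ).mp hℓnq with h | h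
      · exact hno ⟨ℓ, hℓ, h, hℓw⟩
      · rw [(Nat.prime_dvd_prime_iff_eq hℓ hq).mp h] at hℓw
        exact hwv (huniq w hℓw)
  set A : AddSubgroup (Vp W K p) := S.comap
    (resH1Hom (Literature.NumberTheory.EllipticCurves.subgroupIncl (κ.layerSubgroup 0))
      (AddSubgroup.inclusion (geomTorsion_natCast_pow_one W (K := K) (p := p)).le) (fun _ _ ↦ rfl)) with hAdef
  have hXA : X ∈ A := by rw [hAdef, AddSubgroup.mem_comap, hX]; exact hcS
  have hDA : D ∈ A := by rw [hAdef, AddSubgroup.mem_comap, hD]; exact hdS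
  -- (5) the local Weil terms of two classes of `A` vanish at every place `w ≠ v`
  have hA : ∀ Y ∈ A, ∀ Z ∈ A, ∀ w : Place K, w ≠ Sum.inr v →
      (weilContPairingLocal (W.baseChange K) (p ^ 1) e hμ hadd₁ hadd₂ hgal w).cupProduct
        (galoisCohomology.localization ((W.baseChange K).torsionGaloisModule ((p ^ 1 : ℕ) : ℤ)) w 1 Y)
        (galoisCohomology.localization ((W.baseChange K).torsionGaloisModule ((p ^ 1 : ℕ) : ℤ)) w 1 Z) = 0 := by
    intro Y hY Z hZ w hw
    rw [hAdef, AddSubgroup.mem_comap] at hY hZ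
    obtain ⟨hY1, hY2, hY3⟩ := (hmemS _).mp hY
    obtain ⟨hZ1, hZ2, hZ3⟩ := (hmemS _).mp hZ
    -- Kummer isotropy at a place where both classes satisfy the Kummer condition
    have hKum : ∀ w : Place K,
        Y ∈ selmerLocalKer (W.baseChange K) (Place.Completion w) ((p ^ 1 : ℕ) : ℤ) →
        Z ∈ selmerLocalKer (W.baseChange K) (Place.Completion w) ((p ^ 1 : ℕ) : ℤ) →
        (weilContPairingLocal (W.baseChange K) (p ^ 1) e hμ hadd₁ hadd₂ hgal w).cupProduct
          (galoisCohomology.localization ((W.baseChange K).torsionGaloisModule ((p ^ 1 : ℕ) : ℤ)) w 1 Y)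
          (galoisCohomology.localization ((W.baseChange K).torsionGaloisModule ((p ^ 1 : ℕ) : ℤ)) w 1 Z) = 0 := by
      intro w hyw hzw
      rw [← comap_localization_kummerSelmerStructure] at hyw hzw
      exact (W.baseChange K).cupProduct_eq_zero_of_mem_kummerSelmerStructure_of_fact (p ^ 1) e hpZ w
        (kummerClass_cupProduct_kummerClass_eq_zero_holds _) hμ hadd₁ hadd₂ halt hgal hyw hzw
    rcases w with w | w
    · -- the (complex) infinite place: every class is Kummer there
      exact hKum (Sum.inl w) (mem_selmerLocalKer_infinitePlace_of_isImaginaryQuadratic hK _ w Y)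
        (mem_selmerLocalKer_infinitePlace_of_isImaginaryQuadratic hK _ w Z)
    · have hwv : w ≠ v := fun h ↦ hw (by rw [h])
      by_cases hpw : ((p : ℕ) : 𝓞 K) ∈ w.asIdeal
      · -- above `p`: (CTRL)
        exact hKum (Sum.inr w) (hctrl w hpw Y (hY1 w hpw)) (hctrl w hpw Z (hZ1 w hpw))
      · by_cases hex : ∃ ℓ : ℕ, ℓ.Prime ∧ ℓ ∣ n ∧ ((ℓ : ℕ) : 𝓞 K) ∈ w.asIdeal
        · -- a prime of `n`: both classes are ORDINARY, hence TORIC; toric isotropy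
          obtain ⟨ℓ, hℓ, hℓn, hℓw⟩ := hex
          have hℓadmE : IsAdmissiblePrime (W.conductorNorm ℤ) K (fun ℓ ↦ W.frobeniusTrace ℓ) p 1 ℓ := hN' ▸ hn.1.2 ℓ hℓ hℓn
          have hYt := mem_toricLocalKer_of_forall_mem_ordinaryAt W κ hℓadmE hℓw Y (hY2 w hpw ⟨ℓ, hℓ, hℓn, hℓw⟩)
          have hZt := mem_toricLocalKer_of_forall_mem_ordinaryAt W κ hℓadmE hℓw Z (hZ2 w hpw ⟨ℓ, hℓ, hℓn, hℓw⟩)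
          exact weilCupProduct_res_eq_zero_of_valued (W.baseChange K) (p ^ 1) (w.adicCompletion K) e hμ hadd₁ hadd₂ hgal _
            (fun S' hS' T' hT' ↦ weilPairingHom_eq_zero_of_mem_of_card_le (W.baseChange K) (p ^ 1) e hμ hadd₁ hadd₂ halt _
              (natCard_augmentation_le_of_admQ W K p hK.1 ⟨ℓ, hℓadmE⟩ w hℓw) S' T' hS' hT')
            (exists_valued_cocycle_of_mem_toricLocalKer (W.baseChange K) (p ^ 1) (w.adicCompletion K) hYt)
            (exists_valued_cocycle_of_mem_toricLocalKer (W.baseChange K) (p ^ 1) (w.adicCompletion K) hZt)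
        · -- no prime of `n`, `w ≠ v`: both classes are UNRAMIFIED at `w`
          have hYu := hY3 w hpw hex hwv
          have hZu := hZ3 w hpw hex hwv
          by_cases hgoodw : (W.baseChange K).HasGoodReductionAt w
          · -- good place: unramified = Kummer (Gross (7.1))
            have h𝔓 := adicCompletionPrime_mem_primesAbove K w
            exact hKum (Sum.inr w)
              ((resH1Hom_layerZero_mem_unramifiedAt_iff_mem_selmerLocalKer W κ hgoodw hpw h𝔓 Y).mp (hYu _ h𝔓))
              ((resH1Hom_layerZero_mem_unramifiedAt_iff_mem_selmerLocalKer W κ hgoodw hpw h𝔓 Z).mp (hZu _ h𝔓))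
          · -- bad place: (RAM) and the unramified isotropy
            exact weilCupProduct_localization_eq_zero_of_unramified_of_ramified (W.baseChange K) (p ^ 1) e hμ hadd₁ hadd₂ hgal
              halt w (hram w hgoodw hpw)
              (fun 𝔓 h𝔓 ↦ (resH1Hom_layerZero_mem_unramifiedAt_iff W κ 𝔓 Y).mp (hYu 𝔓 h𝔓))
              (fun 𝔓 h𝔓 ↦ (resH1Hom_layerZero_mem_unramifiedAt_iff W κ 𝔓 Z).mp (hZu 𝔓 h𝔓))
  -- (6) Poitou–Tate see-saw at `v`: `loc_v D = a • loc_v X`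
  have hcard := Iso.natCard_galoisCohomology_one_torsion_le_sq (W.baseChange K) (p ^ 1) v hpv1
    (natCard_invariants_le_of_admQ W K p hK.1 ⟨q, hadmE⟩ v hqv)
  obtain ⟨Φ, hΦ⟩ := Iso.exists_addMonoidHom_comp_localization_eq_torsionLocMap (W.baseChange K) (p ^ 1) v
  have hlocX : galoisCohomology.localization ((W.baseChange K).torsionGaloisModule ((p ^ 1 : ℕ) : ℤ)) (Sum.inr v) 1 X ≠ 0 :=
    fun h ↦ hloc (by rw [← hΦ X, h]; exact map_zero Φ)
  obtain ⟨a, ha⟩ := Iso.exists_zsmul_localization_of_forall_ne (W.baseChange K) (p ^ 1) e hμ hadd₁ hadd₂ hgal v hnondeg hcard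
    A hA hDA hXA hlocX
  -- (7) `loc_v (D − a X) = 0`, so the ordinary coordinate of `d − a c` at `𝔓₀` vanishes; `c` is unramified at `𝔓₀`
  have hloc0 : galoisCohomology.localization ((W.baseChange K).torsionGaloisModule ((p ^ 1 : ℕ) : ℤ)) (Sum.inr v) 1 (D - a • X) = 0 := by
    -- (the `ℤ`-action instances on the two spellings of `H¹(K, E[p])` agree only definitionally: state the two linearity facts
    -- with the arguments spelled in `Vp`, proved by the `AddMonoidHom` lemmas)
    have h1 : galoisCohomology.localization ((W.baseChange K).torsionGaloisModule ((p ^ 1 : ℕ) : ℤ)) (Sum.inr v) 1 (D - a • X) =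
        galoisCohomology.localization ((W.baseChange K).torsionGaloisModule ((p ^ 1 : ℕ) : ℤ)) (Sum.inr v) 1 D -
          galoisCohomology.localization ((W.baseChange K).torsionGaloisModule ((p ^ 1 : ℕ) : ℤ)) (Sum.inr v) 1 (a • X) :=
      AddMonoidHom.map_sub _ D (a • X)
    have h2 : galoisCohomology.localization ((W.baseChange K).torsionGaloisModule ((p ^ 1 : ℕ) : ℤ)) (Sum.inr v) 1 (a • X) =
        a • galoisCohomology.localization ((W.baseChange K).torsionGaloisModule ((p ^ 1 : ℕ) : ℤ)) (Sum.inr v) 1 X :=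
      AddMonoidHom.map_zsmul _ a X
    rw [h2, ha, sub_self] at h1
    exact h1
  have hres0 := resOfLe_inertia_resH1Hom_layerZero_eq_zero_of_localization_eq_zero W κ hgoodv hpv' (D - a • X) hloc0
  rw [map_sub, map_zsmul, hD, hX, map_sub, map_zsmul] at hres0
  have hcunr : c ∈ unramifiedAt (W.baseChange K) ((p : ℤ) ^ 1) (κ.layerSubgroup 0) (adicCompletionPrime K v) :=
    ((mem_signedOrdSelmerTorsion_iff c).mp hc).2.2 v hpv' hnov _ (adicCompletionPrime_mem_primesAbove K v)
  rw [resOfLe_inertia_eq_zero_of_mem_unramifiedAt W κ (adicCompletionPrime K v) hcunr, zsmul_zero, sub_zero] at hres0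
  exact hd_ord hres0

end Summit.BirchSwinnertonDyer.BirchSwinnertonDyer.Theorems.SignedBaseChangeAcDivAdmdefHowardVanishing

end
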